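import Summits.Ventures.PercRepro.RankLevelSetRuleQSliceFourthUntrunc

/-!
# PercRepro — THE FOURTH UNTRUNCATED SLICE `u = k + 2` ON THE FAMILIES `k = 11, 12`, AND ON EVERY FAMILY `k ≥ 5`
(night-1, gen 22; dossier §33.7)

On `k = 11, 12` the cell `m = 3` of the slice `u = k + 2` has `T_{k+2}(3) > 1` (1.021, 1.006), so the bottom-regime criterion
of gen 21 needs the cell `m = 4` instead (`T_{k+2}(4) = 0.846, 0.829`) and the cells `m = 2, 3` their exact slack
`1 + ρ(2q+k, q) − ρ(2m+u, m)` (1.90 against `T ≤ 1.25`); the large-q half starts at `m = k² − 2` with the sharper Wallis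
bound (`(k+1)·(2J_2) ≤ 49/50` there) and the concrete binomials `C(125, 5)`, `C(148, 5)`:
* `sliceTail_le_four_of`, `sliceTail_four_eq` — the tail from the cell `m = 4`;
* `fourth_untrunc_two_small`, `fourth_untrunc_three_small`, `fourth_untrunc_bottom_small`, `fourth_untrunc_large_small`;
* **`fourth_untrunc_slice_every_small (k q) (k = 11 ∨ k = 12) (k + 2 ≤ q)`**;
* **`fourth_untrunc_slice_every_all (k q) (5 ≤ k) (k + 2 ≤ q) : Φ(q+k, q) ≤ R̂(q, k, q − (k + 2))`** — THE FOURTH UNTRUNCATED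
  SLICE IS PAID ON EVERY CELL OF EVERY FAMILY `k ≥ 5` (`k ≤ 10`: `rhat_slice_iff_all_ten`; `k = 11, 12`: here; `k ≥ 13`:
  `fourth_untrunc_slice_every`); **`ruleQRecv_ge_phiK_fourth_untrunc_all`** — the matroid level.
Axioms: standard.
-/

namespace PercRepro

open Finset

/-- `T_u(m) ≤ T_u(4)` for `4 ≤ m`, `m + u ≤ k(k+1)` (`sliceTail_succ_le_self` iterated). -/
lemma sliceTail_le_four_of (u k m : ℕ) (h4 : 4 ≤ m) (hm : m + u ≤ k * (k + 1)) :
    sliceTail u k m ≤ sliceTail u k 4 := by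
  obtain ⟨d, rfl⟩ : ∃ d, m = 4 + d := ⟨m - 4, by omega⟩
  induction d with
  | zero => simp
  | succ d ih =>
    calc sliceTail u k (4 + (d + 1)) = sliceTail u k (4 + d + 1) := by rw [Nat.add_assoc]
      _ ≤ sliceTail u k (4 + d) := sliceTail_succ_le_self u k (4 + d) (by omega)
      _ ≤ sliceTail u k 4 := ih (by omega) (by omega)

/-- `sliceTail u k 4` as a `range` sum (for the concrete evaluations). -/
lemma sliceTail_four_eq (u k : ℕ) :
    sliceTail u k 4 = ∑ i ∈ range (u + 1), ((u + k).choose (k + i) : ℚ)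
      * ∑ a ∈ range (4 + 1), ((4 : ℕ).choose a : ℚ) / ((4 + u + (k + i) + a).choose (a + (k + i)) : ℚ) := by
  unfold sliceTail
  have h : Finset.Icc k (u + k) = Finset.Ico k (u + k + 1) := by
    ext j; simp only [Finset.mem_Icc, Finset.mem_Ico]; omega
  rw [h, Finset.sum_Ico_eq_sum_range, show u + k + 1 - k = u + 1 by omega]

/-- `T_{13}(4) ≤ 1` (`k = 11`) and `T_{14}(4) ≤ 1` (`k = 12`), exactly. -/
lemma sliceTail_kp2_four_le_one_small (k : ℕ) (hk : k = 11 ∨ k = 12) : sliceTail (k + 2) k 4 ≤ 1 := by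
  rw [sliceTail_four_eq]
  rcases hk with rfl | rfl <;>
    (simp only [Finset.sum_range_succ, Finset.sum_range_zero, Nat.choose_eq_descFactorial_div_factorial]
     norm_num [Nat.descFactorial, Nat.factorial])

/-- **The bottom regime of `u = k + 2` on `k = 11, 12` from the cell `m = 4`**: `4 ≤ m ≤ k² − 2`. -/
theorem fourth_untrunc_bottom_small (k m : ℕ) (hk : k = 11 ∨ k = 12) (h4 : 4 ≤ m) (hm : m + 2 ≤ k * k) :
    phiK (m + (k + 2) + k) (m + (k + 2)) ≤ rhat (m + (k + 2)) k m := by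
  have hk1 : 1 ≤ k := by omega
  apply phiK_le_rhat_of_sliceTail_le_one (k + 2) k m hk1 (by nlinarith)
  exact (sliceTail_le_four_of (k + 2) k m h4 (by nlinarith)).trans (sliceTail_kp2_four_le_one_small k hk)

/-- **The cell `m = 3` of `u = k + 2` on `k = 11, 12`** by the exact slack. -/
theorem fourth_untrunc_three_small (k : ℕ) (hk : k = 11 ∨ k = 12) :
    phiK (3 + (k + 2) + k) (3 + (k + 2)) ≤ rhat (3 + (k + 2)) k 3 := by
  apply phiK_le_rhat_of_sliceTail (k + 2) k 3 (by omega)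
  rw [sliceTail_three_eq]
  rcases hk with rfl | rfl <;>
    (simp only [Finset.sum_range_succ, Finset.sum_range_zero, sliceThreeTerm, Nat.choose_eq_descFactorial_div_factorial]
     norm_num [Nat.descFactorial, Nat.factorial])

/-- **The cell `m = 2` of `u = k + 2` on `k = 11, 12`** by the exact slack. -/
theorem fourth_untrunc_two_small (k : ℕ) (hk : k = 11 ∨ k = 12) :
    phiK (2 + (k + 2) + k) (2 + (k + 2)) ≤ rhat (2 + (k + 2)) k 2 := by
  apply phiK_le_rhat_of_sliceTail (k + 2) k 2 (by omega)
  rw [sliceTail_two_eq]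
  rcases hk with rfl | rfl <;>
    (simp only [Finset.sum_range_succ, Finset.sum_range_zero, sliceTwoTerm, Nat.choose_eq_descFactorial_div_factorial]
     norm_num [Nat.descFactorial, Nat.factorial])

/-- **The monotone step on `k = 11, 12`** from `m = k² − 2` on: `C(2k+1, k−1)·S_k(q, m) ≤ S_1(q, m)`, `q = m + k + 2`. -/
lemma step_fourth_small (k m : ℕ) (hk : k = 11 ∨ k = 12) (hm : k * k ≤ m + 2) :
    ((k + 1 + k).choose (k - 1) : ℚ) * sliceS (m + 1 + (k + 1)) m k ≤ sliceS (m + 1 + (k + 1)) m 1 := by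
  have hlow := sliceS_one_ge m (k + 1)
  have hup := sliceS_le_odd m k 5 (show m + 1 ≤ m + 1 + (k + 1) by omega) (by omega)
  have hρ := diag_two_sq_le_sharper m
  have hρ0 : (0 : ℚ) ≤ 2 * sliceS (m + 1) m 2 := by
    have := sliceS_nonneg (m + 1) m 2; positivity
  -- (k+1)·2J_2 ≤ 49/50 on m ≥ k² − 2
  have h1 : ((k : ℚ) + 1) * (2 * sliceS (m + 1) m 2) ≤ 49 / 50 := by
    have hsq : (((k : ℚ) + 1) * (2 * sliceS (m + 1) m 2)) ^ 2 ≤ (49 / 50) ^ 2 := by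
      calc (((k : ℚ) + 1) * (2 * sliceS (m + 1) m 2)) ^ 2
          = ((k : ℚ) + 1) ^ 2 * (2 * sliceS (m + 1) m 2) ^ 2 := by ring
        _ ≤ ((k : ℚ) + 1) ^ 2 * (4 / (5 * (m : ℚ) + 9)) := by gcongr
        _ ≤ (49 / 50) ^ 2 := by
            rw [show ((k : ℚ) + 1) ^ 2 * (4 / (5 * (m : ℚ) + 9)) = 4 * ((k : ℚ) + 1) ^ 2 / (5 * (m : ℚ) + 9) by
              field_simp, div_le_iff₀ (by positivity)]
            have hmq : (k : ℚ) * k ≤ (m : ℚ) + 2 := by exact_mod_cast hm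
            rcases hk with rfl | rfl <;> (push_cast at hmq ⊢; norm_num at hmq ⊢; linarith [hmq])
    nlinarith [hsq, hρ0]
  -- 50·C(2k+1, k−1) ≤ C(m+6, 5)
  have hTq : (50 : ℚ) * ((k + 1 + k).choose (k - 1) : ℚ) ≤ ((m + 5 + 1).choose 5 : ℚ) := by
    have hmono : ∀ N, N ≤ m + 6 → N.choose 5 ≤ (m + 5 + 1).choose 5 := fun N hN => Nat.choose_le_choose 5 hN
    rcases hk with rfl | rfl
    · have h := hmono 125 (by omega)
      have e : 50 * Nat.choose (11 + 1 + 11) (11 - 1) ≤ Nat.choose 125 5 := by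
        rw [show Nat.choose (11 + 1 + 11) (11 - 1) = 1144066 by decide,
          show Nat.choose 125 5 = 234531275 by
            rw [Nat.choose_eq_descFactorial_div_factorial]; norm_num [Nat.descFactorial, Nat.factorial]]
        norm_num
      exact_mod_cast e.trans h
    · have h := hmono 148 (by omega)
      have e : 50 * Nat.choose (12 + 1 + 12) (12 - 1) ≤ Nat.choose 148 5 := by
        rw [show Nat.choose (12 + 1 + 12) (12 - 1) = 4457400 by decide,
          show Nat.choose 148 5 = 552689424 by
            rw [Nat.choose_eq_descFactorial_div_factorial]; norm_num [Nat.descFactorial, Nat.factorial]]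
        norm_num
      exact_mod_cast e.trans h
  have hB : (0 : ℚ) < ((m + 5 + 1).choose 5 : ℚ) := Nat.cast_pos.mpr (Nat.choose_pos (by omega))
  have h2 : ((k + 1 + k).choose (k - 1) : ℚ) / ((m + 5 + 1).choose 5 : ℚ) ≤ 1 / 50 := by
    rw [div_le_iff₀ hB]; linarith
  calc ((k + 1 + k).choose (k - 1) : ℚ) * sliceS (m + 1 + (k + 1)) m k
      ≤ ((k + 1 + k).choose (k - 1) : ℚ)
          * (((m + 1 + (k + 1) : ℕ) : ℚ) / ((m : ℚ) + 1) * (1 / (2 * ((m + 5 + 1).choose 5 : ℚ)))) :=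
        mul_le_mul_of_nonneg_left hup (by positivity)
    _ = ((k + 1 + k).choose (k - 1) : ℚ) / ((m + 5 + 1).choose 5 : ℚ)
          * (((m + 1 + (k + 1) : ℕ) : ℚ) / (2 * ((m : ℚ) + 1))) := by
        field_simp
    _ ≤ 1 / 50 * (((m + 1 + (k + 1) : ℕ) : ℚ) / (2 * ((m : ℚ) + 1))) :=
        mul_le_mul_of_nonneg_right h2 (by positivity)
    _ ≤ ((m + 1 + (k + 1) : ℕ) : ℚ) / (2 * ((m : ℚ) + 1)) * (1 - ((k + 1 : ℕ) : ℚ) * (2 * sliceS (m + 1) m 2)) := by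
        have hy0 : (0 : ℚ) ≤ ((m + 1 + (k + 1) : ℕ) : ℚ) / (2 * ((m : ℚ) + 1)) := by positivity
        have h1' : ((k + 1 : ℕ) : ℚ) * (2 * sliceS (m + 1) m 2) ≤ 49 / 50 := by push_cast; exact h1
        have := mul_le_mul_of_nonneg_left h1' hy0
        nlinarith [this, hy0]
    _ ≤ sliceS (m + 1 + (k + 1)) m 1 := hlow

/-- **The large-q half of `u = k + 2` on `k = 11, 12`** (`m ≥ k² − 2`). -/
theorem fourth_untrunc_large_small (k m : ℕ) (hk : k = 11 ∨ k = 12) (hm : k * k ≤ m + 2) :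
    phiK (m + 1 + (k + 1) + k) (m + 1 + (k + 1)) ≤ rhat (m + 1 + (k + 1)) k m := by
  have h1 : phiK (m + 1 + (k + 1) + k) (m + 1 + (k + 1)) ≤ rhat (m + 1 + (k + 1)) k (m + 1) := by
    have := third_untrunc_slice_every k (m + 1 + (k + 1)) (by omega) (by omega)
    rwa [show m + 1 + (k + 1) - (k + 1) = m + 1 by omega] at this
  have h2 := rhat_le_sliceL_of_untrunc (m + 1 + (k + 1)) k (m + 1) (by omega)
  have h1' : phiK (m + 1 + (k + 1) + k) (m + 1 + (k + 1))
      ≤ ∑ j ∈ Finset.Ioo 0 k, ((m + 1 + (k + 1) + k - (m + 1)).choose j : ℚ)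
          * ∑ a ∈ range (m + 1 + 1), ((m + 1).choose a : ℚ) / ((m + 1 + (k + 1) + j + a).choose (a + j) : ℚ) :=
    h1.trans h2
  exact phiK_le_rhat_of_sliceStep (k + 1) k m (by omega) h1' (step_fourth_small k m hk hm)

/-- **THE FOURTH UNTRUNCATED SLICE ON `k = 11, 12`, EVERY CELL.** -/
theorem fourth_untrunc_slice_every_small (k q : ℕ) (hk : k = 11 ∨ k = 12) (hq : k + 2 ≤ q) :
    phiK (q + k) q ≤ rhat q k (q - (k + 2)) := by
  obtain ⟨m, rfl⟩ : ∃ m, q = m + (k + 2) := ⟨q - (k + 2), by omega⟩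
  rw [show m + (k + 2) - (k + 2) = m by omega]
  rcases Nat.lt_or_ge m 4 with hm4 | hm4
  · rcases Nat.lt_or_ge m 1 with hm0 | hm1
    · have : m = 0 := by omega
      subst this
      rw [rhat_zero_eq _ _ (by omega)]
    · rcases Nat.lt_or_ge m 2 with hm1' | hm2
      · have : m = 1 := by omega
        subst this
        exact rhatCell_one (1 + (k + 2)) k (by omega) (by omega)
      · rcases Nat.lt_or_ge m 3 with hm2' | hm3
        · have : m = 2 := by omega
          subst this
          exact fourth_untrunc_two_small k hk
        · have : m = 3 := by omega
          subst this
          exact fourth_untrunc_three_small k hk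
  · rcases Nat.lt_or_ge (m + 2) (k * k) with hsmall | hlarge
    · exact fourth_untrunc_bottom_small k m hk hm4 (by omega)
    · have := fourth_untrunc_large_small k m hk hlarge
      rwa [show m + 1 + (k + 1) = m + (k + 2) by ring] at this

/-- **THE FOURTH UNTRUNCATED SLICE `u = k + 2` IS PAID ON EVERY CELL OF EVERY FAMILY `k ≥ 5`.** -/
theorem fourth_untrunc_slice_every_all (k q : ℕ) (hk : 5 ≤ k) (hq : k + 2 ≤ q) :
    phiK (q + k) q ≤ rhat q k (q - (k + 2)) := by
  rcases Nat.lt_or_ge k 11 with h10 | h11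
  · exact ((rhat_slice_iff_all_ten k (k + 2) hk (by omega)).mpr (Or.inr (by omega))) q hq
  · rcases Nat.lt_or_ge k 13 with h12 | h13
    · exact fourth_untrunc_slice_every_small k q (by omega) hq
    · exact fourth_untrunc_slice_every k q h13 hq

/-- **THE MATROID LEVEL**: at the tight layer every member at distance `k + 2` from the top is paid (`k ≥ 5`, `q ≥ k + 2`). -/
theorem ruleQRecv_ge_phiK_fourth_untrunc_all {β : Type} (M : Matroid β) [M.Finite] {q k : ℕ} (hk : 5 ≤ k)
    (hq : k + 2 ≤ q) (hE : M.E.ncard = (q + k) + q) {Z : Set β} (hZ : Z ∈ cellMembers M (q + k) q)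
    (hP : (flatPart M Z).ncard = q - (k + 2)) :
    phiK (q + k) q ≤ ruleQRecv M (q + k) q Z := by
  have h1 := fourth_untrunc_slice_every_all k q hk hq
  have h2 := rhat_le_ruleQRecv M hE hZ
  rw [hP] at h2
  exact h1.trans h2

end PercRepro
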